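import Literature.Barriers.Schanuel.EFunctionValuesAtAlgebraicPointsAnalytic
import HarnessLib

/-!
# Barrier (Schanuel) `EFunctionValuesAtAlgebraicPoints`: the values at a regular point are not all zero — proofs only

`Literature/Barriers/Schanuel/EFunctionValuesAtAlgebraicPointsNonvanishing.lean` — sibling file
of `EFunctionValuesAtAlgebraicPoints.lean` in the programme to discharge
`siegelShidlovskii_algIndep` (Siegel–Shidlovskii; Rivoal Thm. 5.10 = Baker Thm. 11.1), on the
way to Rivoal's rank theorem 5.20 (`shidlovskii_rankBound`). The rank argument (Baker Ch. 11 §4: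
"We shall suppose also, as clearly we may, that `𝓔₁(α) ≠ 0`") needs one of the values `Fᵢ(α)` to
be non-zero; for a general solution vector of `T Y′ = B Y` this is the uniqueness of solutions at
a REGULAR point `T(α) ≠ 0`:

* `SiegelShidlovskii.IsSol.eq_zero_of_constantCoeff` — formal version in `K⟦X⟧`: if `f(0) ≠ 0`,
  `f Yᵢ′ = ∑ Gᵢⱼ Yⱼ` and all `Yᵢ(0) = 0`, then `Y = 0` (coefficient recursion);
* `SiegelShidlovskii.eSeries_eq_zero_of_apply_eq_zero` — for entire `Fᵢ = ∑ aᵢ(n) zⁿ/n!` with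
  `T Fᵢ′ = ∑ Bᵢⱼ Fⱼ` and `T(α) ≠ 0`: if all `Fᵢ(α) = 0` then all `Fᵢ ≡ 0` (shift to `α`, take
  Taylor series, apply the formal version).

All [folklore]; no named facts.

## References

* A. Baker, *Transcendental Number Theory*, CUP 1975, Ch. 11 §4 (p. 113).
* [Rivoal2024] T. Rivoal, *Les E-fonctions et G-fonctions de Siegel* (2024), Théorème 5.20.
-/

noncomputable section

open Polynomial
open scoped Nat

namespace Literature.Barriers.Schanuel

namespace SiegelShidlovskii

/-! ### 1. Formal uniqueness at a regular point -/

section Formal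

variable {K : Type*} [Field K] [CharZero K] {n : ℕ}

/-- **Formal uniqueness**: if `f(0) ≠ 0`, `f · Yᵢ′ = ∑ⱼ Gᵢⱼ Yⱼ` in `K⟦X⟧` and `Yᵢ(0) = 0` for all
`i`, then `Y = 0`. [folklore] -/
theorem IsSol.eq_zero_of_constantCoeff {f : K[X]} {G : Matrix (Fin n) (Fin n) K[X]}
    {Y : Fin n → PowerSeries K} (hY : IsSol (coeAlgHom K) (PowerSeries.derivative K) f G Y)
    (hf : f.coeff 0 ≠ 0) (h0 : ∀ i, PowerSeries.constantCoeff (Y i) = 0) : Y = 0 := by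
  -- all coefficients vanish, by strong induction on the index
  suffices hall : ∀ N i, PowerSeries.coeff N (Y i) = 0 by
    funext i; ext N; simpa using hall N i
  intro N
  induction N using Nat.strong_induction_on with
  | _ N ih =>
    intro i
    rcases N with _ | N
    · simpa using h0 i
    -- compare the coefficients of `X^N` in `f Yᵢ′ = ∑ Gᵢⱼ Yⱼ`
    have h := congr_arg (PowerSeries.coeff N) (hY i)
    rw [coeAlgHom_apply, PowerSeries.coeff_mul, map_sum, Finset.sum_eq_single (0, N)] at h
    · -- left side: only the term `(0, N)` survives; right side: every term has a factor
      -- `coeff t (Y j)` with `t ≤ N`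
      have hR : ∑ j, PowerSeries.coeff N (coeAlgHom K (G i j) * Y j) = 0 := by
        refine Finset.sum_eq_zero fun j _ => ?_
        rw [PowerSeries.coeff_mul]
        refine Finset.sum_eq_zero fun p hp => ?_
        have : p.2 ≤ N := by have := Finset.HasAntidiagonal.mem_antidiagonal.mp hp; omega
        rw [ih p.2 (by omega) j, mul_zero]
      rw [hR, Polynomial.coeff_coe, PowerSeries.coeff_derivative] at h
      have hN : ((N : K) + 1) ≠ 0 := by exact_mod_cast Nat.succ_ne_zero N
      rcases mul_eq_zero.mp h with h1 | h2
      · exact absurd h1 hf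
      · exact (mul_eq_zero.mp h2).resolve_right hN
    · rintro ⟨s, t⟩ hst hne
      have hst' : s + t = N := Finset.HasAntidiagonal.mem_antidiagonal.mp hst
      have hs : s ≠ 0 := by
        rintro rfl
        exact hne (by simp_all)
      rw [PowerSeries.coeff_derivative, ih (t + 1) (by omega) i, zero_mul, mul_zero]
    · intro h'
      exact absurd (Finset.HasAntidiagonal.mem_antidiagonal.mpr (by simp)) h'

end Formal

/-! ### 2. Entire solutions vanishing at a regular point vanish identically -/

/-- Taylor series of the zero function. [folklore] -/
theorem taylorPS_zero : taylorPS (fun _ : ℂ => (0 : ℂ)) = 0 := by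
  ext n
  simp [taylorPS]

/-- **Values at a regular point are not all zero, unless the functions are.** Let
`Fᵢ = eSeries aᵢ` be entire (`ExpBound aᵢ`) with `T(z) Fᵢ′(z) = ∑ⱼ Bᵢⱼ(z) Fⱼ(z)` and `T(α) ≠ 0`.
If `Fᵢ(α) = 0` for all `i` then `Fᵢ ≡ 0` for all `i`. [folklore] -/
theorem eSeries_eq_zero_of_apply_eq_zero {n : ℕ} (a : Fin n → ℕ → ℂ) (ha : ∀ i, ExpBound (a i))
    (T : ℂ[X]) (B : Matrix (Fin n) (Fin n) ℂ[X])
    (hsys : ∀ i z, T.eval z * deriv (eSeries (a i)) z = ∑ j, (B i j).eval z * eSeries (a j) z)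
    {α : ℂ} (hTα : T.eval α ≠ 0) (hzero : ∀ i, eSeries (a i) α = 0) (i : Fin n) :
    eSeries (a i) = fun _ => 0 := by
  -- shift to `α`
  set G : Fin n → ℂ → ℂ := fun i z => eSeries (a i) (z + α) with hG
  have hGd : ∀ i, Differentiable ℂ (G i) := fun i =>
    (differentiable_eSeries (ha i)).comp (differentiable_id.add_const α)
  have hGderiv : ∀ i z, deriv (G i) z = deriv (eSeries (a i)) (z + α) := fun i z => by
    simp only [hG]
    exact deriv_comp_add_const (eSeries (a i)) α z
  set Tα : ℂ[X] := T.comp (X + C α) with hTα'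
  set Bα : Matrix (Fin n) (Fin n) ℂ[X] := fun i j => (B i j).comp (X + C α) with hBα
  have hsysα : ∀ i z, Tα.eval z * deriv (G i) z = ∑ j, (Bα i j).eval z * G j z := by
    intro i z
    simp only [hTα', hBα, eval_comp, eval_add, eval_X, eval_C, hGderiv]
    exact hsys i (z + α)
  have hderivG : ∀ i, deriv (G i) = fun z => eSeries (fun m => a i (m + 1)) (z + α) := by
    intro i; funext z; rw [hGderiv, deriv_eSeries (ha i)]
  have hGd' : ∀ i, Differentiable ℂ (deriv (G i)) := fun i => by
    rw [hderivG]
    exact (differentiable_eSeries (ha i).shift).comp (differentiable_id.add_const α)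
  -- Taylor series: a formal solution with zero constant terms
  set Y : Fin n → PowerSeries ℂ := fun i => taylorPS (G i) with hY
  have hsol : IsSol (coeAlgHom ℂ) (PowerSeries.derivative ℂ) Tα Bα Y := by
    intro i
    have hfun : (fun z => Tα.eval z * deriv (G i) z) = fun z => ∑ j, (Bα i j).eval z * G j z :=
      funext (hsysα i)
    have hl : taylorPS (fun z => Tα.eval z * deriv (G i) z) =
        (Tα : PowerSeries ℂ) * PowerSeries.derivative ℂ (Y i) := by
      rw [show (fun z => Tα.eval z * deriv (G i) z) = (fun z => Tα.eval z) * deriv (G i) from rfl,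
        taylorPS_mul Tα.differentiable (hGd' i), taylorPS_polynomial, taylorPS_deriv]
    have hr : taylorPS (fun z => ∑ j, (Bα i j).eval z * G j z) =
        ∑ j, ((Bα i j : ℂ[X]) : PowerSeries ℂ) * Y j := by
      rw [taylorPS_sum Finset.univ (fun j z => (Bα i j).eval z * G j z)
        (fun j _ => (Bα i j).differentiable.mul (hGd j))]
      refine Finset.sum_congr rfl fun j _ => ?_
      rw [show (fun z => (Bα i j).eval z * G j z) = (fun z => (Bα i j).eval z) * G j from rfl,
        taylorPS_mul (Bα i j).differentiable (hGd j), taylorPS_polynomial]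
    show coeAlgHom ℂ Tα * PowerSeries.derivative ℂ (Y i) = ∑ j, coeAlgHom ℂ (Bα i j) * Y j
    simp only [coeAlgHom_apply]
    rw [← hl, hfun, hr]
  have hT0 : Tα.coeff 0 ≠ 0 := by
    rw [Polynomial.coeff_zero_eq_eval_zero]
    simp only [hTα', eval_comp, eval_add, eval_X, eval_C, zero_add]
    exact hTα
  have hY0 : ∀ i, PowerSeries.constantCoeff (Y i) = 0 := by
    intro i
    rw [← PowerSeries.coeff_zero_eq_constantCoeff_apply, hY]
    simp [coeff_taylorPS, hG, hzero i]
  have hYz := hsol.eq_zero_of_constantCoeff hT0 hY0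
  have hGi : G i = fun _ => 0 :=
    taylorPS_inj (hGd i) (differentiable_const 0) (by rw [taylorPS_zero]; exact congr_fun hYz i)
  funext z
  have := congr_fun hGi (z - α)
  simpa [hG] using this

end SiegelShidlovskii

end Literature.Barriers.Schanuel

end
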